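import Summits.BirchSwinnertonDyer.BirchSwinnertonDyer.Theorems.ThetaPartnerAtTwoSignedControlAtTwoShaThreeBaseOfBrauer
import Literature.NumberTheory.GaloisCohomology.BrauerClassLocalVanishing
import Literature.NumberTheory.GaloisCohomology.PoitouTatePrimePowerRealVanishing
import Literature.NumberTheory.GaloisCohomology.PoitouTateTwoRealPlacesSurjectiveHolds
import Literature.NumberTheory.GaloisRepresentations.CyclicClassLevelChange
import HarnessLib

/-!
# A Brauer class of a number field with trivial real localisations is twice a Brauer class — the input (hBr) of
# `ShaThree.realThree_injective_orderTwo_of_brauer` (K4 `SignedControlAtTwo`, stub 3 `stub_realThreeOrderTwoBase`)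

Route `ThetaPartnerAtTwo` (TP2; crux shared with `ResidualThetaTransportAtTwo`), crux K4 `SignedControlAtTwo`
(stmt-BirchSwinnertonDyer-20309), line `eulerchar` (skeleton v14), stub `stub_realThreeOrderTwoBase` = the base case of Milne I
Thm. 4.10 (c)₃ (`H³(F, ℤ/2) ↪ ⊕_{w real} H³(F_w, ℤ/2)`), reduced by the lead's B7 (`…ShaThreeBaseOfBrauer`, p623710) to two
statements about `𝔾_m`: (hH3) `H³(F, F̄ˣ)[2] = 0` and (hBr) «a class of `Br(F) = H²(Γ_F, F̄ˣ)` which is twice a class at every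
real place is twice a class».  Seat `prover-bsd-wall-tp2-p3-w3` (width 3/3, gen 9).  THIS FILE PROVES (hBr) FOR EVERY NUMBER FIELD,
unconditionally, by the LEVEL-DOUBLING road (no idèle existence theorem):

* §1 `exists_eq_two_pow_smul_of_two_torsion_of_forall_isReal` — **a `2`-torsion Brauer class `u` with `loc_w u ∈ 2·H²` at every
  real `w` is `2^j`-divisible for every `j`**: Kummer lift `c ∈ H²(Γ_F, μ₂)` (`exists_kummer_eq_of_nsmul_eq_zero`), real vanishing
  and finite support of `c` (`BrauerClassLocalVanishing`), KILLING of the Brauer class on a layer `Γ_{F_M}` of the cyclotomic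
  `ℤ₂`-extension (tree `exists_resH_comap_span_pow_kummer_eq_zero_of_forall_isReal`), hence `u = κ_{ψ_M}(b)` is the cyclic class of
  the layer character `ψ_M = κ mod 2^M` (tree `exists_cyclicClass_eq_of_res_eq_zero`, Hilbert 90 for `Gal(F̄/F_M)`), and
  `κ_{ψ_M}(b) = 2^j • κ_{ψ_{M+j}}(b)` by the change of level for cyclic classes (`CyclicClassLevelChange`, p625580).
* §2 `exists_eq_add_self_of_two_pow_zsmul_eq_zero` — induction on the `2`-exponent: `2^{k+1} u = 0` ⟹ `2^k u = 2^{k+1} x`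
  (§1 with `j = k + 1`) ⟹ `2^k (u - 2x) = 0` ⟹ IH.
* §3 **`realBrauer_two_divisible`** — (hBr) for every number field `F`: `Br(F)` is torsion (`exists_pos_natCast_zsmul_eq_zero`),
  the odd part of a class is trivially `2`-divisible, the `2`-part by §2 (Bézout).
* §4 Consequences: `realThree_injective_orderTwo_of_H3` — the (hbase) input of `poitouTate_three_realPlaces_injective_of_base` at
  `F` from (hH3) ALONE; **`poitouTate_three_realPlaces_injective_of_H3`** — Milne I 4.10(c)₃ `poitouTate_three_realPlaces_injective K`
  for EVERY number field `K` from the single remaining statement (hH3) `∀ F, H³(F, F̄ˣ)[2] = 0` (B7 + w2 g6's Cor. 4.16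
  `poitouTate_two_realPlaces_surjective_holds`).

HONEST FRAMING: THEOREMS ONLY (no definition, no named fact, no `sorry`); (hBr) is UNCONDITIONAL; the stub
`stub_realThreeOrderTwoBase` is now reduced to (hH3) `H³(F, 𝔾_m)[2] = 0` (Tate; class-formation statement, NOT proved here);
closes no item by itself; BSD is not proved by any of this.

References: [SerreLocalFields1979] XIV §1 (`(χ, b)` bilinear), X §4; [CasselsFrohlichANT1967] Ch. VII §10–§11 (every Brauer class is
split by a cyclic cyclotomic extension; `Br(F)/2 ≅ ⊕_real`); [MilneADT2006] I Thm. 4.10 (c), Lemma 4.8.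
-/

set_option autoImplicit false
-- the Theorems namespace of this sub repeats the summit name by design (D-0017 nested layout)
set_option linter.dupNamespace false

noncomputable section

open CategoryTheory NumberField Field Function IsDedekindDomain
open _root_.TopRep _root_.ContRepresentation _root_.ContinuousCohomology
open Literature.NumberTheory.GaloisRepresentations
open Literature.NumberTheory.GaloisRepresentations.DiscreteGaloisModule (mu MuCarrier units UnitsCarrier)
open Literature.NumberTheory.GaloisCohomology
open Literature.NumberTheory.EllipticCurves
open scoped NumberField

namespace Summit.BirchSwinnertonDyer.BirchSwinnertonDyer.Theorems.SignedEC.ShaThreeBrauer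

variable (F : Type) [Field F] [NumberField F]

/-! ## §1 Real-trivial `2`-torsion Brauer classes are cyclic classes of the `ℤ₂`-tower, hence `2^j`-divisible -/

section TwoTorsion

/-- **A `2`-torsion Brauer class with `loc_w u ∈ 2 · H²(Γ_{F_w}, F̄ˣ|)` at every real place `w` is `2^j`-divisible for every
`j`.**  Kummer lift to `H²(Γ_F, μ₂)`; real vanishing + finite support; killing on a layer `Γ_{F_M}` of the cyclotomic
`ℤ₂`-extension; `u` is then the cyclic class `κ_{ψ_M}(b)` of the layer character `ψ_M = κ mod 2^M`, and
`κ_{ψ_M}(b) = 2^j • κ_{ψ_{M+j}}(b)`. [cite: CasselsFrohlichANT1967, Ch. VII §10] [cite: SerreLocalFields1979, XIV §1] -/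
theorem exists_eq_two_pow_smul_of_two_torsion_of_forall_isReal (u : galoisCohomology (units F) 2) (h2 : (2 : ℤ) • u = 0)
    (hreal : ∀ w : InfinitePlace F, w.IsReal → ∃ u' : galoisCohomology ((units F).toLocal (Sum.inl w)) 2,
      galoisCohomology.localization (units F) (Sum.inl w) 2 u = u' + u')
    (j : ℕ) : ∃ x : galoisCohomology (units F) 2, u = 2 ^ j • x := by
  classical
  haveI : CompactSpace (absoluteGaloisGroup F) := absoluteGaloisGroup_compactSpace F
  haveI : Fact (Nat.Prime 2) := ⟨Nat.prime_two⟩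
  -- Kummer preimage at level `2`
  obtain ⟨c, hc⟩ := exists_kummer_eq_of_nsmul_eq_zero F 2 u (by rwa [Nat.cast_ofNat])
  have hc' : (cohomologyMap (kummerι F 2) 2).hom c = u := hc
  -- finite support and real vanishing of `c`
  obtain ⟨S, hS⟩ := exists_finset_forall_localization_inr_eq_zero F c
  have hreal_c : ∀ w : InfinitePlace F, w.IsReal →
      galoisCohomology.localization (mu F 2) (Sum.inl w) 2 c = 0 := fun w hw =>
    localization_inl_eq_zero_of_localization_kummer_eq_add_self w c (by rw [hc']; exact hreal w hw)
  -- the cyclotomic `ℤ₂`-extension and the killing layer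
  obtain ⟨κ, hκ⟩ := ZpExtension.exists_isCyclotomic_holds F 2 (GaloisRep.cyclotomicCharacter_range_infinite F 2)
  obtain ⟨m₀, hm₀⟩ := exists_resH_comap_span_pow_kummer_eq_zero_of_forall_isReal F κ.toContinuousMonoidHom
    (exists_apply_resGal_ne_one_of_isCyclotomic' F 2 hκ) (show (2 : ℕ) ∣ 2 ^ 1 by norm_num) c S hS hreal_c
  have hm₀' : resH (κ.layerSubgroup m₀) (units F) 2 ((cohomologyMap (kummerι F 2) 2).hom c) = 0 := hm₀
  -- level `M = m₀ + 1` (so that `1 < 2^M`)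
  set M : ℕ := m₀ + 1 with hM
  have hVle : κ.layerSubgroup M ≤ κ.layerSubgroup m₀ := κ.layerSubgroup_antitone (Nat.le_succ m₀)
  have hkill : resH (κ.layerSubgroup M) (units F) 2 u = 0 := by
    rw [← hc', resH_eq_resSub_resH (units F) hVle 2, hm₀', map_zero]
  -- the layer character `ψ_M` and the cyclic form of `u`
  obtain ⟨ψ, hkerV, hkerL, hψ⟩ := κ.exists_cyclicCharacter_layer M
  haveI : FiniteDimensional F (κ.layer M) := κ.finiteDimensional_layer_holds M
  haveI : Fact (1 < 2 ^ M) := ⟨Nat.one_lt_two_pow (Nat.succ_ne_zero m₀)⟩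
  have hT : Subsingleton (continuousCohomology 1
      (((units F).restrict (Literature.NumberTheory.GaloisRepresentations.subgroupIncl ψ.ker)).toTopRep)) := by
    rw [hkerL]; exact subsingleton_one_units_galFixing _
  have hres : resH ψ.ker (units F) 2 u = 0 := by rw [hkerV]; exact hkill
  obtain ⟨b, hb⟩ := exists_cyclicClass_eq_of_res_eq_zero ψ (units F) hT u hres
  -- the character of level `M + j` and the change of level
  obtain ⟨ψ', -, -, hψ'⟩ := κ.exists_cyclicCharacter_layer (M + j)
  have hdvd : 2 ^ M ∣ 2 ^ (M + j) := pow_dvd_pow 2 (Nat.le_add_right M j)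
  have hcompat : ∀ σ, ψ σ = ZMod.castHom hdvd (ZMod (2 ^ M)) (ψ' σ) := fun σ => by
    rw [hψ, hψ', ← PadicInt.zmod_cast_comp_toZModPow M (M + j) (Nat.le_add_right M j)]
    rfl
  exact ⟨cyclicClass ψ' (units F) b,
    hb ▸ CyclicCharacter.cyclicClass_eq_smul_cyclicClass_of_mul ψ ψ' hdvd hcompat (units F) (pow_add 2 M j) b⟩

end TwoTorsion

/-! ## §2 Induction on the `2`-exponent -/

section Induction

/-- The real hypothesis «`loc_w u` is twice a class» is inherited by integer multiples. [folklore] -/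
private theorem hreal_zsmul (u : galoisCohomology (units F) 2) (n : ℤ)
    (hreal : ∀ w : InfinitePlace F, w.IsReal → ∃ u' : galoisCohomology ((units F).toLocal (Sum.inl w)) 2,
      galoisCohomology.localization (units F) (Sum.inl w) 2 u = u' + u') :
    ∀ w : InfinitePlace F, w.IsReal → ∃ u' : galoisCohomology ((units F).toLocal (Sum.inl w)) 2,
      galoisCohomology.localization (units F) (Sum.inl w) 2 (n • u) = u' + u' := fun w hw => by
  obtain ⟨u', hu'⟩ := hreal w hw
  exact ⟨n • u', by rw [map_zsmul, hu', smul_add]⟩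

/-- **`2^k · u = 0` and `loc_w u ∈ 2 · H²` at every real `w` ⟹ `u` is twice a Brauer class**, by induction on `k`:
`u₁ = 2^k u` is `2`-torsion, so `u₁ = 2^{k+1} x` (§1), and `u - 2x` is killed by `2^k`.
[cite: CasselsFrohlichANT1967, Ch. VII §10] [cite: SerreLocalFields1979, XIV §1] -/
theorem exists_eq_add_self_of_two_pow_zsmul_eq_zero :
    ∀ (k : ℕ) (u : galoisCohomology (units F) 2), (2 ^ k : ℤ) • u = 0 →
      (∀ w : InfinitePlace F, w.IsReal → ∃ u' : galoisCohomology ((units F).toLocal (Sum.inl w)) 2,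
        galoisCohomology.localization (units F) (Sum.inl w) 2 u = u' + u') →
      ∃ x : galoisCohomology (units F) 2, u = x + x
  | 0, u, h, _ => ⟨0, by rw [pow_zero, one_smul] at h; rw [h, add_zero]⟩
  | k + 1, u, h, hreal => by
    -- `u₁ = 2^k u` is `2`-torsion with the real property
    have h1 : (2 : ℤ) • ((2 ^ k : ℤ) • u) = 0 := by
      rw [smul_smul, show (2 : ℤ) * 2 ^ k = 2 ^ (k + 1) by ring, h]
    obtain ⟨x, hx⟩ := exists_eq_two_pow_smul_of_two_torsion_of_forall_isReal F ((2 ^ k : ℤ) • u) h1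
      (hreal_zsmul F u _ hreal) (k + 1)
    -- `u₂ = u - (x + x)` is killed by `2^k`
    have hx' : (2 ^ k : ℤ) • u = (2 ^ k : ℤ) • (x + x) := by
      rw [hx, smul_add, ← add_smul, ← natCast_zsmul]
      congr 1
      push_cast
      ring
    have h2 : (2 ^ k : ℤ) • (u - (x + x)) = 0 := by rw [smul_sub, hx', sub_self]
    have hreal2 : ∀ w : InfinitePlace F, w.IsReal → ∃ u' : galoisCohomology ((units F).toLocal (Sum.inl w)) 2,
        galoisCohomology.localization (units F) (Sum.inl w) 2 (u - (x + x)) = u' + u' := fun w hw => by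
      obtain ⟨u', hu'⟩ := hreal w hw
      refine ⟨u' - galoisCohomology.localization (units F) (Sum.inl w) 2 x, ?_⟩
      rw [map_sub, hu', map_add]
      abel
    obtain ⟨y, hy⟩ := exists_eq_add_self_of_two_pow_zsmul_eq_zero k (u - (x + x)) h2 hreal2
    refine ⟨x + y, ?_⟩
    rw [← sub_add_cancel u (x + x), hy]
    abel

end Induction

/-! ## §3 (hBr): a Brauer class with trivial real localisations is twice a class -/

section Main

/-- **(hBr) for every number field `F`: a class of `Br(F) = H²(Γ_F, F̄ˣ)` whose localisation at every real place `w` is twice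
a class of `H²(Γ_{F_w}, F̄ˣ|)` (equivalently vanishes, `2 · H²(Γ_{F_w}, ·) = 0`) is twice a class of `Br(F)`** — the injectivity
half of `Br(F)/2 ≅ ⊕_{w real} Br(F_w)`.  `Br(F)` is torsion; the odd part of a class is `2`-divisible for free; the `2`-primary
part by §2. This is EXACTLY the hypothesis (hBr) of `ShaThree.realThree_injective_orderTwo_of_brauer`.
[cite: CasselsFrohlichANT1967, Ch. VII §10–§11] [cite: MilneADT2006, Ch. I, Thm. 4.10 (c)] -/
theorem realBrauer_two_divisible (u : galoisCohomology (units F) 2)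
    (hreal : ∀ w : InfinitePlace F, w.IsReal → ∃ u' : galoisCohomology ((units F).toLocal (Sum.inl w)) 2,
      galoisCohomology.localization (units F) (Sum.inl w) 2 u = u' + u') :
    ∃ u'' : galoisCohomology (units F) 2, u = u'' + u'' := by
  classical
  -- torsion: `N • u = 0`, `N = 2^k m`, `m` odd
  obtain ⟨N, hN, hNu⟩ := exists_pos_natCast_zsmul_eq_zero F u
  obtain ⟨k, m, hm2, hNkm⟩ := Nat.exists_eq_pow_mul_and_not_dvd hN.ne' 2 (by norm_num)
  have hm0 : m ≠ 0 := by rintro rfl; rw [mul_zero] at hNkm; exact hN.ne' hNkm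
  -- Bézout
  have hcop : Nat.Coprime (2 ^ k) m := (Nat.Prime.coprime_iff_not_dvd Nat.prime_two).2 hm2 |>.pow_left k
  obtain ⟨s, t, hst⟩ : ∃ s t : ℤ, s * (2 ^ k : ℕ) + t * m = 1 := Nat.isCoprime_iff_coprime.2 hcop
  -- the part killed by `m` (odd): `a = 2^k u`
  set a : galoisCohomology (units F) 2 := ((2 ^ k : ℕ) : ℤ) • u with ha_def
  have ha : (m : ℤ) • a = 0 := by
    rw [ha_def, smul_smul, ← Nat.cast_mul, mul_comm, ← hNkm]; exact hNu
  have hodd : Odd m := Nat.odd_iff.2 (Nat.two_dvd_ne_zero.1 hm2)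
  obtain ⟨r, hr⟩ := hodd.add_one
  have ha2 : a = (r : ℤ) • a + (r : ℤ) • a := by
    have e : ((m + 1 : ℕ) : ℤ) • a = a := by rw [Nat.cast_succ, add_smul, ha, zero_add, one_smul]
    rw [← add_smul, ← Nat.cast_add, ← hr, e]
  -- the part killed by `2^k`: `b = m u`, twice a class by §2
  set b : galoisCohomology (units F) 2 := (m : ℤ) • u with hb_def
  have hb : (2 ^ k : ℤ) • b = 0 := by
    rw [hb_def, smul_smul, show (2 : ℤ) ^ k * (m : ℤ) = (N : ℤ) by rw [hNkm]; push_cast; ring]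
    exact hNu
  obtain ⟨y, hy⟩ := exists_eq_add_self_of_two_pow_zsmul_eq_zero F k b hb (hreal_zsmul F u _ hreal)
  -- `u = s • a + t • b`
  have hu : u = s • a + t • b := by
    rw [ha_def, hb_def, smul_smul, smul_smul, ← add_smul, hst, one_smul]
  refine ⟨s • ((r : ℤ) • a) + t • y, ?_⟩
  rw [hu, hy, smul_add]
  conv_lhs => rw [ha2, smul_add]
  abel

/-- (hBr) in the «loc_w u = 0» form: a Brauer class VANISHING at every real place is twice a class.
[cite: CasselsFrohlichANT1967, Ch. VII §10–§11] -/
theorem realBrauer_two_divisible_of_localization_eq_zero (u : galoisCohomology (units F) 2)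
    (hreal : ∀ w : InfinitePlace F, w.IsReal → galoisCohomology.localization (units F) (Sum.inl w) 2 u = 0) :
    ∃ u'' : galoisCohomology (units F) 2, u = u'' + u'' :=
  realBrauer_two_divisible F u fun w hw => ⟨0, by rw [hreal w hw, add_zero]⟩

end Main

/-! ## §4 The stub from (hH3) alone -/

section Consequences

/-- **The (hbase) input of `poitouTate_three_realPlaces_injective_of_base` AT `F` from (hH3) `H³(F, F̄ˣ)[2] = 0` ALONE**
(B7 `ShaThree.realThree_injective_orderTwo_of_brauer` with (hBr) discharged by `realBrauer_two_divisible`): for every discrete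
`Γ_F`-module `T` of order `2` with trivial action, a class of `H³(F, T)` vanishing at all real places is `0`.
[cite: MilneADT2006, Ch. I, Thm. 4.10 (c)] [cite: CasselsFrohlichANT1967, Ch. VII §11] -/
theorem realThree_injective_orderTwo_of_H3
    (hH3 : ∀ z : galoisCohomology (units F) 3, z + z = 0 → z = 0)
    (T : Type) [AddCommGroup T] [TopologicalSpace T] [DiscreteTopology T] [Finite T]
    (σT : DiscreteGaloisModule F T) (htriv : ∀ (g : absoluteGaloisGroup F) (t : T), σT g t = t)
    (hcard : Nat.card T = 2) :
    ∀ c : galoisCohomology σT 3,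
      (∀ w : InfinitePlace F, w.IsReal → galoisCohomology.localization σT (Sum.inl w) 3 c = 0) → c = 0 :=
  ShaThree.realThree_injective_orderTwo_of_brauer F hH3 (realBrauer_two_divisible F) T σT htriv hcard

/-- **Milne I Thm. 4.10 (c), `r = 3` — `poitouTate_three_realPlaces_injective K` for every number field `K` — from the single
remaining statement (hH3) `H³(F, F̄ˣ)[2] = 0` for every number field `F`** (B7 `poitouTate_three_realPlaces_injective_of_brauer` with
(hBr) = `realBrauer_two_divisible` and Cor. 4.16 = `poitouTate_two_realPlaces_surjective_holds`).
[cite: MilneADT2006, Ch. I, Thm. 4.10 (c) and Cor. 4.16] [cite: CasselsFrohlichANT1967, Ch. VII §11] -/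
theorem poitouTate_three_realPlaces_injective_of_H3 (K : Type) [Field K] [NumberField K]
    (hH3 : ∀ (F : Type) [Field F] [NumberField F] (z : galoisCohomology (units F) 3), z + z = 0 → z = 0) :
    poitouTate_three_realPlaces_injective K :=
  ShaThree.poitouTate_three_realPlaces_injective_of_brauer K hH3 (fun F _ _ => realBrauer_two_divisible F)
    (fun F _ _ => poitouTate_two_realPlaces_surjective_holds F)

end Consequences

end Summit.BirchSwinnertonDyer.BirchSwinnertonDyer.Theorems.SignedEC.ShaThreeBrauer

end
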